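import Literature.AlgebraicGeometry.CossartJannsenSaito2020.ProjDirProjectiveLineResidue
import Mathlib.FieldTheory.RatFunc.Basic
import Mathlib.Algebra.Polynomial.Div
import HarnessLib

/-!
# CJS LNM 2270, Def. 6.38 (ii) at `e_x(X) = 2`: the generic point of `C_1 = ℙ(Dir_x(X)) ≅ ℙ^1_{k(x)}` has residue
# field `k(x)(T)` — PROOF of the generic-point clause of `ProjDir_projLine_residueFields`

Source: V. Cossart, U. Jannsen, S. Saito, *Desingularization: Invariants and Strategy*, LNM **2270** (2020)
[`CossartJannsenSaito2020`], Def. 6.38 (ii) (p. 105) «`C_1 = ℙ(Dir^O_x(X)) ≅ ℙ^1_{k(x)}`», p. 103 L15–L16 («Let `η_1` be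
the generic point of `C_1`») and L30–L31 / (6.24) (`δ_{η_1/x} = 1`). For a blow-up `π : X' → X` of a locally noetherian `X`
in a closed point `x` with `e_x(X) = 2` and the generic point `η` of `C = projDirectrixFibre π x`, this file constructs an
isomorphism `k(η) ≅ k(x)(T)` (Mathlib `RatFunc`) under which `π^* : k(π η) → k(η)` is the inclusion of constants
(`exists_residueField_iso_ratFunc_of_isGenericPoint`) — the first clause of the named fact `ProjDir_projLine_residueFields`
(`ProjDirProjectiveLine.lean`); with the second clause (`finite_residueFieldMap_of_mem_projDirectrixFibre`,
`ProjDirProjectiveLineResidue.lean`) this DISCHARGES it: **`ProjDir_projLine_residueFields_holds`**.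

Proof. On the chart `g : Spec D → X'` at `c_{j₀}` of an adapted pair (`ProjDirProjectiveLineCharts.lean`), `η = g(𝔑)` for
the prime `𝔑` with `D/𝔑 ≅ k(x)[T]`, `T ↦ t := c_{j₁}/c_{j₀}` (`ProjDirectrixPlaneChart.lean`). Let `t̄ ∈ k(η)` be the value
of `t`. Evaluation `k(πη)[T] → k(η)`, `T ↦ t̄`, is injective (a relation `p̄(t̄) = 0` lifts to `p(t) ∈ 𝔑` with `p ∈ Γ(U)[T]`,
whence `p ∈ 𝔭_x[T]`: `coeff_mem_of_eval₂_mem_chartIdeal`) and every element of `k(η) = Frac(D/𝔑)` is `p̄(t̄)/q̄(t̄)`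
(`exists_polynomial_sub_eval₂_mem_chartIdeal`); so `RatFunc.liftRingHom` is an isomorphism `k(πη)(T) ≅ k(η)`.

NOT a statement of H. Hironaka's manuscript; a PROOF about a typed published statement of [CJS 2020] for the L-lane of
cell res-hironaka ([L W4.2], deal P-a). AI-written; weaker than expert review.

## References

* V. Cossart, U. Jannsen, S. Saito, LNM 2270 (2020), Def. 6.38 (ii), p. 103, p. 105. [CossartJannsenSaito2020]
* The Stacks Project, Tag 0804 (charts of a blowing up). [StacksProject]
-/

noncomputable section

open CategoryTheory AlgebraicGeometry TopologicalSpace IsLocalRing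
open Literature.AlgebraicGeometry.Resolution Literature.RingTheory.HilbertSamuel Literature.RingTheory.MvPolynomial
open scoped Polynomial

namespace Literature.AlgebraicGeometry.CossartJannsenSaito2020

universe u

/-! ## Plumbing (private copies of the chart lemmas of `ProjDirClosed.lean`) -/

/-- The chart `g_j : Spec (R[It])_{(c_j t)} → X'` of a blowing up along `C` over an affine open `U` at a member `c_j` of a
generating family `c` of `C(U)`: an open immersion over `Spec R → X` through `chartBase c j`, containing every point at
which `c_j` generates the exceptional ideal. [cite: StacksProject, Tag 0804] -/
private theorem exists_chart_of_ideal_eq_span₄ {X' X : Scheme.{u}} {π : X' ⟶ X} {C : X.IdealSheafData}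
    (hπ : IsBlowup π C) (U : X.affineOpens) {r : ℕ} (c : Fin r → Γ(X, U))
    (hc : C.ideal U = Ideal.span (Set.range c)) (j : Fin r) :
    ∃ g : Spec (.of (chartRing c j)) ⟶ X', IsOpenImmersion g ∧
      g ≫ π = Spec.map (CommRingCat.ofHom (chartBase c j)) ≫ U.2.fromSpec ∧
      ∀ (x' : X') (hx : π x' ∈ (U : X.Opens)),
        stalkIdeal (C.comap π) x' =
            Ideal.span {(π.stalkMap x').hom ((X.presheaf.germ U (π x') hx).hom (c j))} →
          x' ∈ Set.range g := by
  have key : ∀ (I : Ideal Γ(X, U)) (_ : C.ideal U = I) (b : Γ(X, U)) (hb : b ∈ I),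
      ∃ g : Spec (.of (HomogeneousLocalization.Away (reesGrading I) (reesT b hb))) ⟶ X',
        IsOpenImmersion g ∧
        g ≫ π = Spec.map (CommRingCat.ofHom (reesChartBase b hb)) ≫ U.2.fromSpec ∧
        ∀ (x' : X') (hx : π x' ∈ (U : X.Opens)),
          stalkIdeal (C.comap π) x' =
              Ideal.span {(π.stalkMap x').hom ((X.presheaf.germ U (π x') hx).hom b)} →
            x' ∈ Set.range g := by
    rintro I rfl b hb
    obtain ⟨g, h1, h2, -⟩ := hπ.exists_charts U
    exact ⟨g b hb, h1 b hb, h2 b hb, fun x' hx hgen =>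
      hπ.mem_range_chart_of_stalkIdeal_eq_span U hb (g b hb) (h2 b hb) hx hgen⟩
  exact key _ hc (c j) (Ideal.mem_span_range_self (f := c) (x := j))

/-- On a chart `g : Spec D → X'` with `g ≫ π = Spec f ≫ (Spec Γ(X, U) → X)`:
`g^♯_w ∘ π^♯_{g w} ∘ germ = (D → 𝒪_{Spec D, w}) ∘ f`. [cite: StacksProject, Tag 0804] -/
private theorem stalkMap_stalkMap_germ_of_chart₄ {X' X : Scheme.{u}} (π : X' ⟶ X) (U : X.affineOpens)
    {D : CommRingCat.{u}} (g : Spec D ⟶ X') (f : Γ(X, U) ⟶ D)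
    (hg : g ≫ π = Spec.map f ≫ U.2.fromSpec) (w : Spec D) (hx : π (g w) ∈ (U : X.Opens)) (r : Γ(X, U)) :
    (g.stalkMap w).hom ((π.stalkMap (g w)).hom ((X.presheaf.germ U (π (g w)) hx).hom r)) =
      ((Spec D).presheaf.germ ⊤ w trivial).hom ((Scheme.ΓSpecIso D).inv.hom (f.hom r)) := by
  have e := top_le_preimage_of_chart U g f hg
  have h1 : ((Spec D).presheaf.germ ⊤ w trivial).hom ((g ≫ π).appLE U ⊤ e r) =
      ((g ≫ π).stalkMap w).hom ((X.presheaf.germ U ((g ≫ π) w) (e trivial)).hom r) := by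
    change ((g ≫ π).appLE U ⊤ e ≫ (Spec D).presheaf.germ ⊤ w trivial).hom r =
      (X.presheaf.germ U ((g ≫ π) w) (e trivial) ≫ (g ≫ π).stalkMap w).hom r
    rw [Scheme.Hom.germ_stalkMap, Scheme.Hom.appLE, Category.assoc, (Spec D).presheaf.germ_res]
  rw [appLE_chart_eq U g f hg e, Scheme.Hom.stalkMap_comp] at h1
  exact h1.symm


/-! ## Ring-level facts (private copies) -/
section Quotient

variable {D : Type u} [CommRing D] {k : Type u} [Field k] (N : Ideal D) (Ξ : Polynomial k ≃+* D ⧸ N)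

include Ξ in
/-- An ideal with quotient `≅ k[T]` is prime. [folklore] -/
private theorem isPrime_of_ringEquiv_polynomial₄ : N.IsPrime := by
  haveI : IsDomain (D ⧸ N) := MulEquiv.isDomain (Polynomial k) Ξ.symm.toMulEquiv
  exact (Ideal.Quotient.isDomain_iff_prime N).mp inferInstance

include Ξ in
/-- An ideal with quotient `≅ k[T]` is not maximal (`k[T]` is not a field). [folklore] -/
private theorem not_isMaximal_of_ringEquiv_polynomial₄ : ¬ N.IsMaximal := by
  intro h
  have hF : IsField (D ⧸ N) := (Ideal.Quotient.maximal_ideal_iff_isField_quotient N).mp h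
  exact Polynomial.not_isField k (MulEquiv.isField hF Ξ.toMulEquiv)

include Ξ in
/-- Over an ideal with quotient `≅ k[T]`, every strictly larger prime is maximal (`k[T]` is a PID of dimension one).
[folklore] -/
private theorem isMaximal_of_lt_of_ringEquiv_polynomial₄ (w : Ideal D) [w.IsPrime] (hNw : N ≤ w) (hne : w ≠ N) :
    w.IsMaximal := by
  -- `θ : D → k[T]`, surjective with kernel `N`
  let θ : D →+* Polynomial k := Ξ.symm.toRingHom.comp (Ideal.Quotient.mk N)
  have hθsurj : Function.Surjective θ := Ξ.symm.surjective.comp Ideal.Quotient.mk_surjective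
  have hθker : RingHom.ker θ = N := by
    ext d
    rw [RingHom.mem_ker, RingHom.comp_apply, RingEquiv.toRingHom_eq_coe, RingHom.coe_coe,
      EmbeddingLike.map_eq_zero_iff, Ideal.Quotient.eq_zero_iff_mem]
  have hkw : RingHom.ker θ ≤ w := hθker ▸ hNw
  haveI hq : (w.map θ).IsPrime := Ideal.map_isPrime_of_surjective hθsurj hkw
  have hqne : w.map θ ≠ ⊥ := by
    intro hbot
    apply hne
    refine le_antisymm ?_ hNw
    intro d hd
    have : θ d ∈ w.map θ := Ideal.mem_map_of_mem θ hd
    rw [hbot, Ideal.mem_bot, ← RingHom.mem_ker, hθker] at this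
    exact this
  haveI : (w.map θ).IsMaximal := IsPrime.to_maximal_ideal hqne
  have hcomap : (w.map θ).comap θ = w := by
    rw [Ideal.comap_map_of_surjective θ hθsurj, sup_eq_left]
    intro d hd
    exact hkw hd
  rw [← hcomap]
  exact Ideal.comap_isMaximal_of_surjective θ hθsurj

include Ξ in
/-- If `Ξ(T) = d̄` for the isomorphism `Ξ : k[T] ≅ D/N`, then `d ∉ N`. [folklore] -/
private theorem not_mem_of_ringEquiv_polynomial_X₄ {d : D} (hΞ : Ξ Polynomial.X = Ideal.Quotient.mk N d) : d ∉ N := by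
  intro hd
  have h0 : Ξ Polynomial.X = 0 := by rw [hΞ, Ideal.Quotient.eq_zero_iff_mem]; exact hd
  exact Polynomial.X_ne_zero (Ξ.injective (h0.trans (map_zero Ξ).symm))

end Quotient


/-! ## A local-ring lemma: an invertible ideal generated by two elements is generated by one of them -/

/-- In a local ring, if `(u, v) = (t)` with `t` a nonzerodivisor then `(u) = (t)` or `(v) = (t)`. [folklore] -/
private theorem span_singleton_eq_or_of_span_pair_eq₄ {B : Type u} [CommRing B] [IsLocalRing B] {u v t : B}
    (ht : t ∈ nonZeroDivisors B) (h : Ideal.span {u, v} = Ideal.span {t}) :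
    Ideal.span {u} = Ideal.span {t} ∨ Ideal.span {v} = Ideal.span {t} := by
  obtain ⟨bu, hbu⟩ : ∃ b : B, b * t = u := Ideal.mem_span_singleton'.mp (h ▸ Ideal.subset_span (by simp))
  obtain ⟨bv, hbv⟩ : ∃ b : B, b * t = v := Ideal.mem_span_singleton'.mp (h ▸ Ideal.subset_span (by simp))
  obtain ⟨au, av, hauv⟩ : ∃ au av : B, au * u + av * v = t :=
    Ideal.mem_span_pair.mp (h.symm ▸ Ideal.mem_span_singleton_self t)
  have hsum : au * bu + av * bv = 1 := by
    have h1 : (au * bu + av * bv - 1) * t = 0 := by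
      rw [sub_mul, one_mul, add_mul, mul_assoc, mul_assoc, hbu, hbv, hauv, sub_self]
    exact sub_eq_zero.mp ((mem_nonZeroDivisors_iff_right.mp ht) _ h1)
  rcases IsLocalRing.isUnit_or_isUnit_of_add_one hsum with hu | hv
  · left
    rw [← hbu, Ideal.span_singleton_mul_left_unit (isUnit_of_mul_isUnit_right hu)]
  · right
    rw [← hbv, Ideal.span_singleton_mul_left_unit (isUnit_of_mul_isUnit_right hv)]


/-! ## Symbols: the adapted pair is symmetric -/

/-- If `s ∉ 𝒯` and `s' ∉ 𝒯 + k s` then also `s' ∉ 𝒯` and `s ∉ 𝒯 + k s'`. [folklore] -/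
private theorem pair_symm₄ {k : Type u} [Field k] {V : Type u} [AddCommGroup V] [Module k V] {T : Submodule k V}
    {s s' : V} (hs : s ∉ T) (hs' : s' ∉ T ⊔ k ∙ s) : s' ∉ T ∧ s ∉ T ⊔ k ∙ s' := by
  refine ⟨fun h => hs' (Submodule.mem_sup_left h), fun h => ?_⟩
  obtain ⟨τ, hτ, w, hw, hτw⟩ := Submodule.mem_sup.mp h
  obtain ⟨β, rfl⟩ := Submodule.mem_span_singleton.mp hw
  by_cases hβ : β = 0
  · apply hs
    rw [← hτw, hβ, zero_smul, add_zero]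
    exact hτ
  · apply hs'
    have hs'eq : s' = β⁻¹ • s - β⁻¹ • τ := by
      rw [← hτw, smul_add, smul_smul, inv_mul_cancel₀ hβ, one_smul, add_sub_cancel_left]
    rw [hs'eq]
    exact Submodule.sub_mem _ (Submodule.mem_sup_right (Submodule.smul_mem _ _ (Submodule.mem_span_singleton_self _)))
      (Submodule.mem_sup_left (T.smul_mem _ hτ))



/-! ## One chart: the residue field at the generic point of a chart piece `≅ Spec k[T]` -/

section ChartResidue

variable {X' X : Scheme.{u}} (π : X' ⟶ X) (U : X.affineOpens)
  {D : CommRingCat.{u}} (ψ : Γ(X, U) ⟶ D) (g : Spec D ⟶ X') [IsOpenImmersion g]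
  (hgπ : g ≫ π = Spec.map ψ ≫ U.2.fromSpec) (w : Spec D) (hwU : π (g w) ∈ (U : X.Opens))
  (h𝔭max : (U.2.primeIdealOf ⟨π (g w), hwU⟩).asIdeal.IsMaximal) (t₀ : D)
  (hinj : ∀ P : Polynomial Γ(X, U), Polynomial.eval₂ ψ.hom t₀ P ∈ w.asIdeal →
    ∀ s, P.coeff s ∈ (U.2.primeIdealOf ⟨π (g w), hwU⟩).asIdeal)
  (hsurj : ∀ d : D, ∃ P : Polynomial Γ(X, U), d - Polynomial.eval₂ ψ.hom t₀ P ∈ w.asIdeal)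

include hgπ h𝔭max hinj hsurj in
/-- **The residue field of `X'` at a chart point `g(w)` over a closed point, when `D/𝔭_w` is `k[t₀]` in the sense of
`hinj`/`hsurj`** (every element of `D` is a polynomial in `t₀` over `Γ(X, U)` modulo `𝔭_w`, and such a polynomial lies in
`𝔭_w` only if its coefficients vanish at the point): `k(g w) ≅ k(π g w)(T)`, `T ↦ t̄₀`, compatibly with `π^*`
(`RatFunc.liftRingHom` of the evaluation at `t̄₀`, injective by `hinj`, onto by `hsurj` and `𝒪_{Spec D,w} = D_w`).
[cite: CossartJannsenSaito2020, Def. 6.38 (ii), p. 105] -/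
theorem exists_residueField_iso_ratFunc_of_chart :
    ∃ e : X'.residueField (g w) ≅ CommRingCat.of (RatFunc (X.residueField (π.base (g w)))),
      π.residueFieldMap (g w) ≫ e.hom =
        CommRingCat.ofHom (algebraMap (X.residueField (π.base (g w))) (RatFunc (X.residueField (π.base (g w))))) := by
  classical
  -- the local dictionary at `w`
  let φ' : Γ(X, U) →+* X'.presheaf.stalk (g w) :=
    (π.stalkMap (g w)).hom.comp (X.presheaf.germ U (π.base (g w)) hwU).hom
  let σ : ↑(X'.presheaf.stalk (g w)) ≃+* ↑((Spec D).presheaf.stalk w) := (asIso (g.stalkMap w)).commRingCatIsoToRingEquiv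
  have hσ : ∀ b, σ b = (g.stalkMap w).hom b := fun _ => rfl
  let τ : D ⟶ (Spec D).presheaf.stalk w := (Scheme.ΓSpecIso D).inv ≫ (Spec D).presheaf.germ ⊤ w trivial
  letI : Algebra D ((Spec D).presheaf.stalk w) := τ.hom.toAlgebra
  haveI hlocL : IsLocalization.AtPrime ((Spec D).presheaf.stalk w) w.asIdeal :=
    StructureSheaf.IsLocalization.to_stalk (R := D) w
  have hστ : ∀ s : Γ(X, U), σ (φ' s) = τ.hom (ψ.hom s) := fun s =>
    stalkMap_stalkMap_germ_of_chart₄ π U g ψ hgπ w hwU s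
  have hσm : ∀ b, b ∈ maximalIdeal (X'.presheaf.stalk (g w)) ↔ σ b ∈ maximalIdeal ((Spec D).presheaf.stalk w) := by
    intro b
    rw [mem_maximalIdeal, mem_maximalIdeal, mem_nonunits_iff, mem_nonunits_iff, MulEquiv.isUnit_map σ]
  have hτw : ∀ d : D, d ∈ w.asIdeal ↔ τ.hom d ∈ maximalIdeal ((Spec D).presheaf.stalk w) :=
    fun d => (IsLocalization.AtPrime.to_map_mem_maximal_iff ((Spec D).presheaf.stalk w) w.asIdeal d).symm
  -- residue fields: `K₀ = k(π g w)`, `K₁ = k(g w)`, `ρ₀ : K₀ → K₁`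
  set K₀ := X.residueField (π.base (g w)) with hK₀
  set K₁ := X'.residueField (g w) with hK₁
  let ρ₀ : K₀ →+* K₁ := (π.residueFieldMap (g w)).hom
  let res₁ : X'.presheaf.stalk (g w) →+* K₁ := (X'.residue (g w)).hom
  let res₀ : X.presheaf.stalk (π.base (g w)) →+* K₀ := (X.residue (π.base (g w))).hom
  have hres : ∀ a', ρ₀ (res₀ a') = res₁ ((π.stalkMap (g w)).hom a') := by
    intro a'
    change (X.residue _ ≫ π.residueFieldMap (g w)).hom a' = (π.stalkMap (g w) ≫ X'.residue _).hom a'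
    rw [Scheme.residue_residueFieldMap]
  have hres₁_zero : ∀ b, res₁ b = 0 ↔ b ∈ maximalIdeal (X'.presheaf.stalk (g w)) :=
    fun b => IsLocalRing.residue_eq_zero_iff b
  -- the coefficient map `χ : Γ(X, U) → K₀` is onto, with `𝔭 ⊆ ker`
  set 𝔭 := (U.2.primeIdealOf ⟨π (g w), hwU⟩).asIdeal with h𝔭
  let χ : Γ(X, U) →+* K₀ := res₀.comp (X.presheaf.germ U (π.base (g w)) hwU).hom
  letI : Algebra Γ(X, U) (X.presheaf.stalk (π.base (g w))) :=
    TopCat.Presheaf.algebra_section_stalk X.presheaf (⟨π.base (g w), hwU⟩ : (U : X.Opens))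
  haveI hlocη : IsLocalization.AtPrime (X.presheaf.stalk (π.base (g w))) 𝔭 := U.2.isLocalization_stalk ⟨π.base (g w), hwU⟩
  have hχsurj : Function.Surjective χ := by
    intro q
    obtain ⟨a₀, rfl⟩ := Ideal.Quotient.mk_surjective q
    obtain ⟨⟨ρ, s⟩, hρs⟩ := IsLocalization.surj 𝔭.primeCompl a₀
    obtain ⟨y, i, hi, hyi⟩ := h𝔭max.exists_inv s.2
    refine ⟨y * ρ, ?_⟩
    change res₀ (algebraMap Γ(X, U) _ (y * ρ)) = res₀ a₀
    rw [← sub_eq_zero, ← map_sub]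
    change IsLocalRing.residue _ _ = 0
    rw [IsLocalRing.residue_eq_zero_iff]
    have hs : a₀ * algebraMap Γ(X, U) _ s = algebraMap Γ(X, U) _ ρ := hρs
    have h1 : algebraMap Γ(X, U) (X.presheaf.stalk (π.base (g w))) (y * ρ) - a₀ =
        -(algebraMap Γ(X, U) _ i * a₀) +
          (algebraMap Γ(X, U) _ y * algebraMap Γ(X, U) _ s + algebraMap Γ(X, U) _ i - 1) * a₀ := by
      rw [map_mul]
      linear_combination (-(algebraMap Γ(X, U) (X.presheaf.stalk (π.base (g w))) y)) * hs
    have h2 : algebraMap Γ(X, U) (X.presheaf.stalk (π.base (g w))) y * algebraMap Γ(X, U) _ s +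
        algebraMap Γ(X, U) _ i - 1 = 0 := by
      rw [← map_mul, ← map_add, hyi, map_one, sub_self]
    rw [h1, h2, zero_mul, add_zero]
    exact Submodule.neg_mem _ (Ideal.mul_mem_right _ _
      ((IsLocalization.AtPrime.to_map_mem_maximal_iff _ 𝔭 i).mpr hi))
  have hχker : ∀ ρ ∈ 𝔭, χ ρ = 0 := by
    intro ρ hρ
    change IsLocalRing.residue _ (algebraMap Γ(X, U) (X.presheaf.stalk (π.base (g w))) ρ) = 0
    rw [IsLocalRing.residue_eq_zero_iff]
    exact (IsLocalization.AtPrime.to_map_mem_maximal_iff _ 𝔭 ρ).mpr hρ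
  -- `t̄ ∈ K₁` and the evaluation map
  set t : K₁ := res₁ (σ.symm (τ.hom t₀)) with ht
  let ev : Polynomial K₀ →+* K₁ := Polynomial.eval₂RingHom ρ₀ t
  -- evaluating a lifted polynomial: `ev (P.map χ) = res₁ (σ⁻¹ τ (P(t₀)))`
  have hev : ∀ P : Polynomial Γ(X, U), ev (P.map χ) = res₁ (σ.symm (τ.hom (Polynomial.eval₂ ψ.hom t₀ P))) := by
    intro P
    have hhom : ev.comp (Polynomial.mapRingHom χ) =
        (res₁.comp ((σ.symm : _ →+* _).comp τ.hom)).comp (Polynomial.eval₂RingHom ψ.hom t₀) := by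
      refine Polynomial.ringHom_ext (fun r => ?_) ?_
      · change Polynomial.eval₂ ρ₀ t (Polynomial.map χ (Polynomial.C r)) =
          res₁ (σ.symm (τ.hom (Polynomial.eval₂ ψ.hom t₀ (Polynomial.C r))))
        rw [Polynomial.map_C, Polynomial.eval₂_C, Polynomial.eval₂_C]
        change ρ₀ (res₀ _) = _
        rw [hres, ← hστ r, σ.symm_apply_apply]
        rfl
      · change Polynomial.eval₂ ρ₀ t (Polynomial.map χ Polynomial.X) =
          res₁ (σ.symm (τ.hom (Polynomial.eval₂ ψ.hom t₀ Polynomial.X)))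
        rw [Polynomial.map_X, Polynomial.eval₂_X, Polynomial.eval₂_X]
    exact RingHom.congr_fun hhom P
  -- (T) `t̄` is transcendental over `K₀`
  have hT : ∀ p : Polynomial K₀, ev p = 0 → p = 0 := by
    intro p hp
    obtain ⟨P, rfl⟩ := Polynomial.map_surjective χ hχsurj p
    rw [hev, hres₁_zero, hσm, σ.apply_symm_apply, ← hτw] at hp
    have hcoef := hinj P hp
    ext s
    rw [Polynomial.coeff_map, Polynomial.coeff_zero]
    exact hχker _ (hcoef s)
  have hev0 : ∀ p : Polynomial K₀, p ≠ 0 → ev p ≠ 0 := fun p hp h => hp (hT p h)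
  have hφ : nonZeroDivisors (Polynomial K₀) ≤ (nonZeroDivisors K₁).comap ev := by
    intro p hp
    rw [Submonoid.mem_comap]
    exact mem_nonZeroDivisors_of_ne_zero (hev0 p (nonZeroDivisors.ne_zero hp))
  let Ψ : RatFunc K₀ →+* K₁ := RatFunc.liftRingHom ev hφ
  -- (S) `Ψ` is onto
  have hΨsurj : Function.Surjective Ψ := by
    intro z
    obtain ⟨b, rfl⟩ := IsLocalRing.residue_surjective z
    obtain ⟨⟨d, s⟩, hds⟩ := IsLocalization.surj w.asIdeal.primeCompl (σ b)
    obtain ⟨Pd, hPd⟩ := hsurj d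
    obtain ⟨Ps, hPs⟩ := hsurj (s : D)
    have hvd : res₁ (σ.symm (τ.hom d)) = ev (Pd.map χ) := by
      rw [hev, ← sub_eq_zero, ← map_sub, ← map_sub, ← map_sub, hres₁_zero, hσm, σ.apply_symm_apply, ← hτw]
      exact hPd
    have hvs : res₁ (σ.symm (τ.hom (s : D))) = ev (Ps.map χ) := by
      rw [hev, ← sub_eq_zero, ← map_sub, ← map_sub, ← map_sub, hres₁_zero, hσm, σ.apply_symm_apply, ← hτw]
      exact hPs
    have hvs0 : res₁ (σ.symm (τ.hom (s : D))) ≠ 0 := by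
      rw [Ne, hres₁_zero, hσm, σ.apply_symm_apply, ← hτw]
      exact s.2
    have hbds : b * σ.symm (τ.hom (s : D)) = σ.symm (τ.hom d) := by
      apply σ.injective
      rw [map_mul, σ.apply_symm_apply, σ.apply_symm_apply]
      exact hds
    refine ⟨algebraMap (Polynomial K₀) (RatFunc K₀) (Pd.map χ) / algebraMap (Polynomial K₀) (RatFunc K₀) (Ps.map χ),
      ?_⟩
    change RatFunc.liftRingHom ev hφ _ = res₁ b
    rw [RatFunc.liftRingHom_apply_div, ← hvd, ← hvs, div_eq_iff hvs0, ← hbds, map_mul]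
  have hΨbij : Function.Bijective Ψ := ⟨Ψ.injective, hΨsurj⟩
  let e₀ : RatFunc K₀ ≃+* K₁ := RingEquiv.ofBijective Ψ hΨbij
  refine ⟨e₀.symm.toCommRingCatIso, ?_⟩
  ext a
  change e₀.symm (ρ₀ a) = algebraMap K₀ (RatFunc K₀) a
  rw [RingEquiv.symm_apply_eq]
  change ρ₀ a = RatFunc.liftRingHom ev hφ (algebraMap K₀ (RatFunc K₀) a)
  rw [RatFunc.algebraMap_apply, RatFunc.liftRingHom_apply_div, map_one, div_one]
  change ρ₀ a = Polynomial.eval₂ ρ₀ t (algebraMap K₀ (Polynomial K₀) a)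
  rw [Polynomial.algebraMap_apply, Polynomial.eval₂_C]
  rfl

end ChartResidue

/-! ## The theorem -/

set_option maxHeartbeats 1600000 in
-- one long proof over large chart types (two Rees charts `chartRing c j` over `Γ(X, U)`), as in `ProjDirLine.lean`
/-- **CJS 2020, Def. 6.38 (ii) at `e_x(X) = 2`, generic point of `C_1 ≅ ℙ^1_{k(x)}`, PROVED: `k(η_1) ≅ k(x)(T)`** — for a
blow-up `π : X' ⟶ X` of a locally noetherian `X` in a closed point `x` with `e_x(X) = 2` and a generic point `η` of
`projDirectrixFibre π x`, there is an isomorphism `k(η) ≅ k(π η)(T)` (Mathlib `RatFunc`) under which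
`π^* : k(π η) → k(η)` becomes the inclusion of constants (`δ_{η_1/x} = 1`, p. 103 L30 / (6.24)). First clause of the named
fact `ProjDir_projLine_residueFields`. [cite: CossartJannsenSaito2020, Def. 6.38 (ii), p. 105] -/
theorem exists_residueField_iso_ratFunc_of_isGenericPoint {X X' : Scheme.{u}} [IsLocallyNoetherian X] (π : X' ⟶ X)
    (x : X) (hx : IsClosed ({x} : Set X)) (hπ : IsBlowup π (Scheme.IdealSheafData.vanishingIdeal ⟨{x}, hx⟩))
    (hdir : Scheme.dirDim X x = 2) (η : X') (hη : IsGenericPoint η (projDirectrixFibre π x)) :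
    ∃ e : X'.residueField η ≅ CommRingCat.of (RatFunc (X.residueField (π.base η))),
      π.residueFieldMap η ≫ e.hom =
        CommRingCat.ofHom (algebraMap (X.residueField (π.base η)) (RatFunc (X.residueField (π.base η)))) := by
  have hSclosed : IsClosed (projDirectrixFibre π x) := isClosed_projDirectrixFibre π x hx hπ
  classical
  set S := projDirectrixFibre π x with hS
  -- (0) the centre, an affine open `U ∋ x`, `𝔭 = 𝔭_x ⊆ R = Γ(X, U)`, `𝒪_{X,x} = R_𝔭`
  obtain ⟨U, hxU⟩ : ∃ U : X.affineOpens, x ∈ (U : X.Opens) := by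
    obtain ⟨U₀, hU, hxU, -⟩ :=
      exists_isAffineOpen_mem_and_subset (X := X) (x := x) (U := ⊤) (Opens.mem_top x)
    exact ⟨⟨U₀, hU⟩, hxU⟩
  set A := X.presheaf.stalk x with hA
  obtain ⟨𝔭, h𝔭⟩ : ∃ 𝔭 : PrimeSpectrum Γ(X, U), 𝔭 = U.2.primeIdealOf ⟨x, hxU⟩ := ⟨_, rfl⟩
  haveI h𝔭max : 𝔭.asIdeal.IsMaximal := h𝔭 ▸ U.2.primeIdealOf_isMaximal_of_isClosed ⟨x, hxU⟩ hx
  haveI : IsNoetherianRing Γ(X, U) := IsLocallyNoetherian.component_noetherian U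
  letI : Algebra Γ(X, U) A := TopCat.Presheaf.algebra_section_stalk X.presheaf (⟨x, hxU⟩ : (U : X.Opens))
  haveI hloc : IsLocalization.AtPrime A 𝔭.asIdeal := h𝔭 ▸ U.2.isLocalization_stalk ⟨x, hxU⟩
  have halg : ∀ s : Γ(X, U), algebraMap Γ(X, U) A s = (X.presheaf.germ U x hxU).hom s := fun _ => rfl
  have hI : (Scheme.IdealSheafData.vanishingIdeal (⟨{x}, hx⟩ : Closeds X)).ideal U = 𝔭.asIdeal := by
    rw [h𝔭]
    exact vanishingIdeal_singleton_ideal U.2 hx hxU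
  obtain ⟨r, c, hc⟩ : ∃ (r : ℕ) (c : Fin r → Γ(X, U)), Ideal.span (Set.range c) = 𝔭.asIdeal :=
    Submodule.fg_iff_exists_fin_generating_family.mp (IsNoetherian.noetherian 𝔭.asIdeal)
  have hIc : (Scheme.IdealSheafData.vanishingIdeal (⟨{x}, hx⟩ : Closeds X)).ideal U = Ideal.span (Set.range c) :=
    hI.trans hc.symm
  have hcm : ∀ l, algebraMap Γ(X, U) A (c l) ∈ maximalIdeal A :=
    fun l => (IsLocalization.AtPrime.to_map_mem_maximal_iff A 𝔭.asIdeal (c l)).mpr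
      (hc ▸ Ideal.subset_span ⟨l, rfl⟩)
  have hspanA : Ideal.span (Set.range fun l => algebraMap Γ(X, U) A (c l)) = maximalIdeal A := by
    have h := IsLocalization.AtPrime.map_eq_maximalIdeal 𝔭.asIdeal A
    rwa [← hc, Ideal.map_span, ← Set.range_comp] at h
  have hexp : ∀ l, ∃ a : Fin (maximalIdeal A).spanFinrank → A,
      ∑ i, a i * minGenerators A i = algebraMap Γ(X, U) A (c l) :=
    fun l => Ideal.mem_span_range_iff_exists_fun.mp (by rw [span_range_minGenerators]; exact hcm l)
  choose a ha using hexp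
  have ha' : ∀ l, algebraMap Γ(X, U) A (c l) = ∑ i, a l i * minGenerators A i := fun l => (ha l).symm
  have hd : directrixDim (tangentConeIdeal (minGenerators A) (span_range_minGenerators A)) = 2 := hdir
  -- (1) the charts at the generators, and the chart description of `S`
  have hcharts := fun j => exists_chart_of_ideal_eq_span₄ hπ U c hIc j
  choose g hgopen hgπ hgmem using hcharts
  have hkey : ∀ (j : Fin r) (w : Spec (.of (chartRing c j))),
      g j w ∈ S ↔
        ((U.2.primeIdealOf ⟨x, hxU⟩).asIdeal.map (CommRingCat.ofHom (chartBase c j)).hom ⊔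
          Ideal.span {d : chartRing c j | ∃ lam : Fin r → Γ(X, U),
            (linForm fun i => ∑ l, residue (X.presheaf.stalk x) ((X.presheaf.germ U x hxU).hom (lam l)) *
                residue (X.presheaf.stalk x) (a l i)) ∈
              directrixSpace (canonicalTangentConeIdeal (X.presheaf.stalk x)) ∧
            d = ∑ l, (CommRingCat.ofHom (chartBase c j)).hom (lam l) * chartGen c j l}) ≤ w.asIdeal := by
    intro j w
    haveI := hgopen j
    exact mem_projDirectrixFibre_chart_iff π U hxU (CommRingCat.ofHom (chartBase c j)) c j
      (fun l => chartGen c j l) a (g j) (hgπ j) (fun k => reesChartBase_apply_eq_mul_chartGen c j k)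
      (reesChartBase_mem_nonZeroDivisors (c j) (Ideal.mem_span_range_self (f := c) (x := j))) hx
      (h𝔭 ▸ hc) ha w
  -- (2) an adapted pair of generators `c_{j₀}, c_{j₁}`
  obtain ⟨j₀, j₁, hj₀, hj₁⟩ := exists_pair_symbols_compl_directrixSpace (span_range_minGenerators A) rfl hspanA a ha' hd
  -- (3) per-chart structure for an adapted ordered pair `(i, i')`, with the isomorphism `Ξ`
  letI instF : Field (Γ(X, U) ⧸ 𝔭.asIdeal) := Ideal.Quotient.field 𝔭.asIdeal
  have hchart : ∀ (i i' : Fin r),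
      linForm (fun m => residue A (a i m)) ∉
        directrixSpace (tangentConeIdeal (minGenerators A) (span_range_minGenerators A)) →
      linForm (fun m => residue A (a i' m)) ∉
        directrixSpace (tangentConeIdeal (minGenerators A) (span_range_minGenerators A)) ⊔
          (ResidueField A) ∙ linForm (fun m => residue A (a i m)) →
      ∃ (N : Ideal (chartRing c i)) (_ : Polynomial (Γ(X, U) ⧸ 𝔭.asIdeal) ≃+* chartRing c i ⧸ N),
        (∀ w : Spec (.of (chartRing c i)), g i w ∈ S ↔ N ≤ w.asIdeal) ∧
        N.IsPrime ∧ ¬ N.IsMaximal ∧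
        (∀ w : Ideal (chartRing c i), w.IsPrime → N ≤ w → w ≠ N → w.IsMaximal) ∧ chartGen c i i' ∉ N ∧
        (∀ p : Polynomial Γ(X, U), Polynomial.eval₂ (chartBase c i) (chartGen c i i') p ∈ N →
          ∀ s, p.coeff s ∈ 𝔭.asIdeal) ∧
        (∀ d : chartRing c i, ∃ p : Polynomial Γ(X, U),
          d - Polynomial.eval₂ (chartBase c i) (chartGen c i i') p ∈ N) := by
    intro i i' hi hi'
    obtain ⟨Ξ, -, hΞX⟩ := exists_ringEquiv_polynomial_quotient_chartIdeal 𝔭.asIdeal A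
      (span_range_minGenerators A) a ha (chartBase c i) (fun l => chartGen c i l) i i' (chartGen_self c i)
      (fun d => exists_isHomogeneous_eval₂_eq c i d) (fun m F hF => reesChartBase_eval_eq_pow_mul_eval₂ c i hF)
      (fun z hz => exists_pow_mul_eq_zero_of_reesChartBase_eq_zero c i hz) hi hi' hd
    refine ⟨_, Ξ, fun w => ?_, isPrime_of_ringEquiv_polynomial₄ _ Ξ, not_isMaximal_of_ringEquiv_polynomial₄ _ Ξ,
      fun w hw hNw hne => ?_, ?_, fun p hp s => ?_, fun d => ?_⟩
    · rw [hkey i w, h𝔭]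
      exact Iff.rfl
    · haveI := hw
      exact isMaximal_of_lt_of_ringEquiv_polynomial₄ _ Ξ w hNw hne
    · exact not_mem_of_ringEquiv_polynomial_X₄ _ Ξ hΞX
    · exact coeff_mem_of_eval₂_mem_chartIdeal 𝔭.asIdeal A (span_range_minGenerators A) a ha (chartBase c i)
        (fun l => chartGen c i l) i i' (chartGen_self c i) (fun d => exists_isHomogeneous_eval₂_eq c i d)
        (fun m F hF => reesChartBase_eval_eq_pow_mul_eval₂ c i hF)
        (fun z hz => exists_pow_mul_eq_zero_of_reesChartBase_eq_zero c i hz) hi hi' hd hp s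
    · exact exists_polynomial_sub_eval₂_mem_chartIdeal 𝔭.asIdeal A (span_range_minGenerators A) a (chartBase c i)
        (fun l => chartGen c i l) i i' (chartGen_self c i) (fun d => exists_isHomogeneous_eval₂_eq c i d) hi hi' hd d
  obtain ⟨N₀, Ξ₀, hkey₀, hprime₀, hnmax₀, hmax₀, hgen₀, hinj₀, hsurj₀⟩ := hchart j₀ j₁ hj₀ hj₁
  obtain ⟨hj₁', hj₀'⟩ := pair_symm₄ hj₀ hj₁
  obtain ⟨N₁, Ξ₁, hkey₁, hprime₁, hnmax₁, hmax₁, hgen₁, -, -⟩ := hchart j₁ j₀ hj₁' hj₀'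
  haveI := hgopen j₀
  haveI := hgopen j₁
  set η₀pt : Spec (.of (chartRing c j₀)) := ⟨N₀, hprime₀⟩ with hη₀pt
  set η₁pt : Spec (.of (chartRing c j₁)) := ⟨N₁, hprime₁⟩ with hη₁pt
  have hη₀S : g j₀ η₀pt ∈ S := (hkey₀ η₀pt).mpr le_rfl
  have hη₁S : g j₁ η₁pt ∈ S := (hkey₁ η₁pt).mpr le_rfl
  -- (4) every point of `S` lies on one of the two charts
  have hcover2 : ∀ ξ ∈ S, ξ ∈ Set.range (g j₀) ∨ ξ ∈ Set.range (g j₁) := by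
    intro ξ hξ
    obtain ⟨hξx, hP⟩ := (mem_projDirectrixFibre π x ξ).mp hξ
    have hξU : π.base ξ ∈ (U : X.Opens) := hξx ▸ hxU
    let ι : A ≅ X.presheaf.stalk (π.base ξ) := X.presheaf.stalkCongr (.of_eq hξx.symm)
    haveI : IsLocalHom (π.stalkMap ξ).hom := π.toLRSHom.prop ξ
    let φ : A →+* X'.presheaf.stalk ξ := (π.stalkMap ξ).hom.comp ι.hom.hom
    have hφgerm : ∀ s : Γ(X, U), φ (algebraMap Γ(X, U) A s) =
        (π.stalkMap ξ).hom ((X.presheaf.germ U (π.base ξ) hξU).hom s) := by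
      intro s
      rw [halg, RingHom.comp_apply]
      change (π.stalkMap ξ).hom ((X.presheaf.germ U x hxU ≫ ι.hom).hom s) = _
      rw [TopCat.Presheaf.stalkCongr_hom, TopCat.Presheaf.germ_stalkSpecializes]
    have hφm : (maximalIdeal A).map φ ≤ maximalIdeal (X'.presheaf.stalk ξ) := by
      rw [Ideal.map_le_iff_le_comap]
      intro m hm
      rw [Ideal.mem_comap, RingHom.comp_apply]
      refine map_nonunit (π.stalkMap ξ).hom _ ?_
      rw [mem_maximalIdeal, mem_nonunits_iff] at hm ⊢
      have h2 : ι.inv.hom (ι.hom.hom m) = m := by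
        change (ι.hom ≫ ι.inv).hom m = m
        rw [Iso.hom_inv_id]
        rfl
      exact fun hu => hm (h2 ▸ hu.map ι.inv.hom)
    have hPφ : ProjDirLiftsInto φ (minGenerators A) (span_range_minGenerators A) :=
      (isOnProjDirectrix_iff_projDirLiftsInto π hξx).mp hP
    have hpair := map_maximalIdeal_eq_span_pair_of_projDirLiftsInto (span_range_minGenerators A) a ha' hj₀ hj₁ hd φ
      hφm hPφ
    obtain ⟨t, ht, hKt⟩ := hπ.isEffectiveCartier.exists_stalkIdeal_eq_span ξ
    have hK : stalkIdeal ((Scheme.IdealSheafData.vanishingIdeal (⟨{x}, hx⟩ : Closeds X)).comap π) ξ =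
        Ideal.span {(π.stalkMap ξ).hom ((X.presheaf.germ U (π.base ξ) hξU).hom (c j₀)),
          (π.stalkMap ξ).hom ((X.presheaf.germ U (π.base ξ) hξU).hom (c j₁))} := by
      rw [stalkIdeal_comap_eq_map, stalkIdeal_eq_map_germ _ U hξU, hIc, Ideal.map_map, Ideal.map_span,
        ← Set.range_comp]
      have h1 : Ideal.span (Set.range (((π.stalkMap ξ).hom.comp (X.presheaf.germ U (π.base ξ) hξU).hom) ∘ c)) =
          (maximalIdeal A).map φ := by
        rw [← hspanA, Ideal.map_span, ← Set.range_comp]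
        exact congrArg Ideal.span (congrArg Set.range (funext fun l => (hφgerm (c l)).symm))
      rw [h1, hpair, hφgerm, hφgerm]
    rcases span_singleton_eq_or_of_span_pair_eq₄ ht (hK.symm.trans hKt) with h0 | h1
    · exact Or.inl (hgmem j₀ ξ hξU (hKt.trans h0.symm))
    · exact Or.inr (hgmem j₁ ξ hξU (hKt.trans h1.symm))
  -- (5) specialisation from the chart generic points; both are generic points of `S`
  have hspec₀ : ∀ w : Spec (.of (chartRing c j₀)), g j₀ w ∈ S → g j₀ η₀pt ⤳ g j₀ w := by
    intro w hw
    have hsp : η₀pt ⤳ w :=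
      (PrimeSpectrum.le_iff_specializes η₀pt w).mp ((PrimeSpectrum.asIdeal_le_asIdeal η₀pt w).mp ((hkey₀ w).mp hw))
    exact hsp.map (g j₀).continuous
  have hspec₁ : ∀ w : Spec (.of (chartRing c j₁)), g j₁ w ∈ S → g j₁ η₁pt ⤳ g j₁ w := by
    intro w hw
    have hsp : η₁pt ⤳ w :=
      (PrimeSpectrum.le_iff_specializes η₁pt w).mp ((PrimeSpectrum.asIdeal_le_asIdeal η₁pt w).mp ((hkey₁ w).mp hw))
    exact hsp.map (g j₁).continuous
  have hη₁range₀ : g j₁ η₁pt ∈ Set.range (g j₀) := by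
    have hwU : π (g j₁ η₁pt) ∈ (U : X.Opens) := ((mem_projDirectrixFibre π x _).mp hη₁S).1 ▸ hxU
    exact hgmem j₀ _ hwU (stalkIdeal_exceptional_eq_span_of_notMem π U (CommRingCat.ofHom (chartBase c j₁)) c j₁
      (fun l => chartGen c j₁ l) (g j₁) (hgπ j₁) (fun k => reesChartBase_apply_eq_mul_chartGen c j₁ k) hx hIc
      η₁pt hwU j₀ hgen₁)
  have hη₀range₁ : g j₀ η₀pt ∈ Set.range (g j₁) := by
    have hwU : π (g j₀ η₀pt) ∈ (U : X.Opens) := ((mem_projDirectrixFibre π x _).mp hη₀S).1 ▸ hxU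
    exact hgmem j₁ _ hwU (stalkIdeal_exceptional_eq_span_of_notMem π U (CommRingCat.ofHom (chartBase c j₀)) c j₀
      (fun l => chartGen c j₀ l) (g j₀) (hgπ j₀) (fun k => reesChartBase_apply_eq_mul_chartGen c j₀ k) hx hIc
      η₀pt hwU j₁ hgen₀)
  have hη₀η₁ : g j₀ η₀pt ⤳ g j₁ η₁pt := by
    obtain ⟨w, hw⟩ := hη₁range₀
    rw [← hw]
    exact hspec₀ w (hw ▸ hη₁S)
  have hη₁η₀ : g j₁ η₁pt ⤳ g j₀ η₀pt := by
    obtain ⟨w, hw⟩ := hη₀range₁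
    rw [← hw]
    exact hspec₁ w (hw ▸ hη₀S)
  have hgen : ∀ ξ ∈ S, g j₀ η₀pt ⤳ ξ := by
    intro ξ hξ
    rcases hcover2 ξ hξ with ⟨w, rfl⟩ | ⟨w, rfl⟩
    · exact hspec₀ w hξ
    · exact hη₀η₁.trans (hspec₁ w hξ)
  have hGP₀ : IsGenericPoint (g j₀ η₀pt) S := by
    refine isGenericPoint_iff_specializes.mpr fun ξ => ⟨fun h => ?_, fun h => hgen ξ h⟩
    exact hSclosed.closure_subset_iff.mpr (Set.singleton_subset_iff.mpr hη₀S) (specializes_iff_mem_closure.mp h)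
  have hGP₁ : IsGenericPoint (g j₁ η₁pt) S := by
    refine isGenericPoint_iff_specializes.mpr fun ξ => ⟨fun h => ?_, fun h => hη₁η₀.trans (hgen ξ h)⟩
    exact hSclosed.closure_subset_iff.mpr (Set.singleton_subset_iff.mpr hη₁S) (specializes_iff_mem_closure.mp h)
  -- (6) `η = g_{j₀}(𝔑₀)`; the residue field computation on the chart
  have hηeq : η = g j₀ η₀pt := hη.eq hGP₀
  subst hηeq
  have hwx : π.base (g j₀ η₀pt) = x := ((mem_projDirectrixFibre π x _).mp hη₀S).1
  have hwU : π.base (g j₀ η₀pt) ∈ (U : X.Opens) := hwx ▸ hxU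
  have h𝔭eq : (U.2.primeIdealOf ⟨π (g j₀ η₀pt), hwU⟩).asIdeal = 𝔭.asIdeal := by
    rw [h𝔭]
    congr 2
    exact Subtype.ext hwx
  have h𝔭max' : (U.2.primeIdealOf ⟨π (g j₀ η₀pt), hwU⟩).asIdeal.IsMaximal := h𝔭eq ▸ h𝔭max
  refine exists_residueField_iso_ratFunc_of_chart π U (CommRingCat.ofHom (chartBase c j₀)) (g j₀) (hgπ j₀) η₀pt hwU
    h𝔭max' (chartGen c j₀ j₁) (fun P hP s => ?_) (fun d => hsurj₀ d)
  rw [h𝔭eq]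
  exact hinj₀ P hP s

/-- **CJS 2020, Def. 6.38 (ii) at `t = e_x(X) = 2`, residue fields of `C_1 = ℙ(Dir_x(X)) ≅ ℙ^1_{k(x)}`, PROVED** —
discharges the named fact `ProjDir_projLine_residueFields` of `ProjDirProjectiveLine.lean`: the generic point has residue
field `k(x)(T)` (`exists_residueField_iso_ratFunc_of_isGenericPoint`), the other points have residue fields finite over
`k(x)` (`finite_residueFieldMap_of_mem_projDirectrixFibre`, `ProjDirProjectiveLineResidue.lean`).
[cite: CossartJannsenSaito2020, Def. 6.38 (ii), p. 105] -/
theorem ProjDir_projLine_residueFields_holds : ProjDir_projLine_residueFields.{u} := by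
  intro X X' _ π x hx hπ hdir
  exact ⟨fun η hη => exists_residueField_iso_ratFunc_of_isGenericPoint π x hx hπ hdir η hη,
    fun y hy hny => finite_residueFieldMap_of_mem_projDirectrixFibre π x hx hπ hdir y hy hny⟩

end Literature.AlgebraicGeometry.CossartJannsenSaito2020

end
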